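import Summits.BirchSwinnertonDyer.Rank1Residual.Additive.RamifiedSevenGenusPartnerTransport
import Literature.NumberTheory.EllipticCurves.Kato2004.IwasawaCohomologyNumberFieldRestriction
import Literature.NumberTheory.EllipticCurves.IsogenyGroundFieldExtension
import HarnessLib

/-!
# (T4) The `res`-square for the transported partner pins: `res₂ = res` on the SAME carriers

Pen D1126 (R-a) row (T4) / D1128 (critic NOTE #15 (1)) / D1133 («g35's day one»), route `K7r`, crux
`stmt-BirchSwinnertonDyer-19945`; companion of `RamifiedSevenGenusPartnerTransport.lean` ((T1)–(T3), p823222).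

With the partner's pins realised by TRANSPORT OF STRUCTURE on the member's carriers —
`I₂ := PartnerTransport.transportQ I β α …` (`ℚ`-side, `proj₂ := β_* ∘ proj`) and
`IK₂ := PartnerTransport.transport IK β_K α_K …` (`K`-side, `proj₂ := (β_K)_* ∘ proj`, `β_K := β.extendScalars K`) —
the restriction `res₂ : I₂.H → IK₂.H` of `IwasawaH1Data.resOver` IS the member's `res : I.H → IK.H` (same function on the same
types).  By the joint injectivity of the layer projections this is ONE levelwise square,
`res_n ∘ β_* = (β_K)_* ∘ res_n : H¹(ℚ_n, T_pW) → H¹(K_n, T_p(W₂)_K)`, which — both maps being functorialities of continuous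
`H¹` on explicit cocycles — is ONE square of coefficient maps, `θ_∞^{W₂} ∘ T_pβ = T_p(β_K) ∘ θ_∞^{W}` on `T_pW`, i.e. on points
`ι_* ∘ β = β_K ∘ ι_*` for the tree's chosen embedding `ι = closureEmb = absClosureEmbedding : ℚ̄ → K̄` (the two base-change
point maps of the tree, `geomPointsMapOfEmb W closureEmb` (file `TateModuleBaseChange`) and `W.geomPointsExtend K (absClosureEquiv ℚ K)`
(file `IsogenyGroundFieldExtension`), AGREE — §1 — because `closureEmb` and `absClosureEquiv` are the same `IsAlgClosed.lift`).
Everything is general: any number field `K`, any prime `p`, any `ℚ`-isogeny.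

## Contents
* §1 `geomPointsMapOfEmb_closureEmb_eq_geomPointsExtend` (the two point maps agree), `tateModuleEquiv_map_isogeny`
  (the coefficient square `θ_∞ ∘ T_pβ = T_pβ_K ∘ θ_∞`), `extendScalars_extendScalars_eq_zsmul` (`α_K ∘ β_K = [e]` from `α ∘ β = [e]`).
* §2 `layerResOver_isogenyMapH1` (the levelwise `H¹` square `res_n ∘ β_* = (β_K)_* ∘ res_n`).
* §3 ★ `resOver_transportQ_transport` (`I₂.resOver IK₂ hγ hγK = I.resOver IK hγ hγK` pointwise) and the packaged form
  `resOver_transportQ_transport'` with the `K`-side dual-pair hypotheses DERIVED from the `ℚ`-side ones.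

References: Serre, *Galois Cohomology*, I §2.4 (compatible pairs; functoriality of `H¹`); Neukirch–Schmidt–Wingberg,
*Cohomology of Number Fields*, I §5 Prop. 1.5.4; Silverman, *AEC*, III §4 (isogenies are defined over `K̄`), III §7 (`T_ℓ` is a functor);
Rubin, *Euler Systems*, App. B §3 (maps into inverse limits are determined levelwise); Kato, Astérisque 295, §12.2 (p. 220).
-/

set_option autoImplicit false

noncomputable section

open scoped NumberField Classical
open Field IsDedekindDomain NumberField WeierstrassCurve
open Literature.NumberTheory.GaloisRepresentations
open Literature.NumberTheory.EllipticCurves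
open Literature.NumberTheory.EllipticCurves.Kato2004
open Literature.NumberTheory.EllipticCurves.Kato2004.CM (tateRepK)
open Literature.NumberTheory.EllipticCurves.Kato2004.EulerSystemValues (tateRep)

namespace Summit.BirchSwinnertonDyer.Rank1Residual.Additive.GenusSeven

namespace PartnerTransport

/-! ## §1 The coefficient square `θ_∞ ∘ T_pβ = T_p(β_K) ∘ θ_∞` -/

section Coefficients

variable (W : WeierstrassCurve ℚ) (K : Type) [Field K] [NumberField K]

/-- **The tree's two base-change point maps agree**: `geomPointsMapOfEmb W closureEmb` (`TateModuleBaseChange`, through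
`localPoints` and `congrEquiv`) and `W.geomPointsExtend K (absClosureEquiv ℚ K)` (`IsogenyGroundFieldExtension`, `Affine.Point.map`)
are the same map `E(ℚ̄) → E_K(K̄)`, `(x, y) ↦ (ι x, ι y)` — `closureEmb` and `absClosureEquiv ℚ K` are both `IsAlgClosed.lift`.
[cite: SilvermanAEC2009, III.§2 and VIII.§1 (points under base extension)] -/
theorem geomPointsMapOfEmb_closureEmb_eq_geomPointsExtend (P : W.geomPoints) :
    geomPointsMapOfEmb W (closureEmb (K := ℚ) K) P = W.geomPointsExtend K (absClosureEquiv ℚ K) P := by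
  rcases P with _ | ⟨x, y, h⟩
  · exact (map_zero _).trans (map_zero _).symm
  · rw [geomPointsMapOfEmb_apply]
    change Affine.Point.congrEquiv _ (Affine.Point.map (closureEmb (K := ℚ) K) (Affine.Point.some x y h)) =
      Affine.Point.map (W' := W) (absClosureEquiv ℚ K).toAlgHom (Affine.Point.some x y h)
    rw [Affine.Point.map_some, Affine.Point.map_some, Affine.Point.congrEquiv_some]
    rfl

variable {W} in
/-- **The coefficient square** `θ_∞^{W₂} (T_pβ m) = T_p(β_K) (θ_∞^{W} m)` for a `ℚ`-isogeny `β : W → W₂`, its ground-field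
extension `β_K = β.extendScalars K`, and the base-change identifications `θ_∞ = tateModuleEquiv _ K p` (`T_p` is a functor,
`TateModule.map_comp`, and `β_K ∘ ι_* = ι_* ∘ β` on points, `Isogeny.extendScalarsOfAlgEquiv_apply_geomPointsExtend`).
[cite: SilvermanAEC2009, III.§4 (p. 66) and III.§7 (T_ℓ as a functor)] -/
theorem tateModuleEquiv_map_isogeny [W.IsElliptic] {W₂ : WeierstrassCurve ℚ} [W₂.IsElliptic] (p : ℕ) [Fact p.Prime]
    (β : Isogeny W W₂)
    (m : W.tateModule p) :
    tateModuleEquiv W₂ K p (TateModule.map p β.toAddMonoidHom m) =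
      TateModule.map p (β.extendScalars K).toAddMonoidHom (tateModuleEquiv W K p m) := by
  rw [tateModuleEquiv_eq, tateModuleEquivOfEmb_apply, tateModuleEquiv_eq, tateModuleEquivOfEmb_apply,
    ← LinearMap.comp_apply, ← TateModule.map_comp, ← LinearMap.comp_apply, ← TateModule.map_comp]
  congr 2
  ext P
  change geomPointsMapOfEmb W₂ (closureEmb (K := ℚ) K) (β P) =
    (β.extendScalars K) (geomPointsMapOfEmb W (closureEmb (K := ℚ) K) P)
  rw [geomPointsMapOfEmb_closureEmb_eq_geomPointsExtend, geomPointsMapOfEmb_closureEmb_eq_geomPointsExtend]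
  exact (Isogeny.extendScalarsOfAlgEquiv_apply_geomPointsExtend (absClosureEquiv ℚ K) β P).symm

variable {W} in
/-- **`α_K ∘ β_K = [e]` from `α ∘ β = [e]`**: the ground-field extensions of a dual pair of `ℚ`-isogenies form a dual pair
(`β_K (ι_* P) = ι_* (β P)` and `ι_*` is onto `E_K(K̄)`). [cite: SilvermanAEC2009, III.§4 (p. 66) and III.§6 (dual isogeny)] -/
theorem extendScalars_extendScalars_eq_zsmul {W₂ : WeierstrassCurve ℚ} (β : Isogeny W W₂) (α : Isogeny W₂ W) {e : ℤ}
    (hαβ : ∀ P, α (β P) = e • P) (Q : (W.baseChange K).geomPoints) :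
    α.extendScalars K (β.extendScalars K Q) = e • Q := by
  obtain ⟨P, rfl⟩ := (W.geomPointsExtend K (absClosureEquiv ℚ K)).surjective Q
  change α.extendScalarsOfAlgEquiv (absClosureEquiv ℚ K) (β.extendScalarsOfAlgEquiv (absClosureEquiv ℚ K)
    (W.geomPointsExtend K (absClosureEquiv ℚ K) P)) = e • W.geomPointsExtend K (absClosureEquiv ℚ K) P
  rw [Isogeny.extendScalarsOfAlgEquiv_apply_geomPointsExtend, Isogeny.extendScalarsOfAlgEquiv_apply_geomPointsExtend, hαβ,
    map_zsmul]

end Coefficients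

/-! ## §2 The levelwise `H¹` square `res_n ∘ β_* = (β_K)_* ∘ res_n` -/

section Layer

variable {W W₂ : WeierstrassCurve ℚ} [W.IsElliptic] [W₂.IsElliptic] {p : ℕ} [Fact p.Prime]
  [ContinuousSMul ℤ_[p] (W.tateModule p)] [ContinuousSMul ℤ_[p] (W₂.tateModule p)]
  (K : Type) [Field K] [NumberField K]
  [ContinuousSMul ℤ_[p] ((W.baseChange K).tateModule p)] [ContinuousSMul ℤ_[p] ((W₂.baseChange K).tateModule p)]
  (κ : ZpExtension ℚ p) (h : Function.Surjective (κ.toContinuousMonoidHom.comp (absGaloisRestrict ℚ K)))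

/-- **The levelwise square** `res_n (β_* c) = (β_K)_* (res_n c)` for `res_n : H¹(ℚ_n, T_pW) → H¹(K_n, T_pW_K)` (`layerResOver`),
the `ℚ`-side push-forward `β_*` (`isogenyMapH1`) and the `K`-side push-forward `(β_K)_*` (`isogenyLayerMapK`, `β_K = β.extendScalars K`):
on explicit cocycles both sides are `g ↦ (coefficient map) (θ (res g))`, and the coefficient maps agree by `tateModuleEquiv_map_isogeny`.
[cite: SerreGaloisCohomology1997, I §2.4 (compatible pairs)] [cite: NeukirchSchmidtWingberg2008, I §5 Prop. 1.5.4] -/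
theorem layerResOver_isogenyMapH1 (β : Isogeny W W₂) (n : ℕ) (c : H1 (tateRep W p) (κ.layerSubgroup n)) :
    layerResOver κ h W₂ n (isogenyMapH1 p β (κ.layerSubgroup n) c) =
      isogenyLayerMapK p (β.extendScalars K) ((κ.restrict K h).layerSubgroup n) (layerResOver κ h W n c) := by
  obtain ⟨θ, rfl⟩ := oneCocycleClass_surjective _ c
  rw [isogenyMapH1_oneCocycleClass, layerResOver_oneCocycleClass, layerResOver_oneCocycleClass,
    isogenyLayerMapK_oneCocycleClass]
  refine congrArg _ (Subtype.ext (ContinuousMap.ext fun g ↦ ?_))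
  change tateModuleEquiv W₂ K p (TateModule.map p β.toAddMonoidHom (θ.1 (layerResHom κ h n g))) =
    TateModule.map p (β.extendScalars K).toAddMonoidHom (tateModuleEquiv W K p (θ.1 (layerResHom κ h n g)))
  exact tateModuleEquiv_map_isogeny K p β _

end Layer

/-! ## §3 ★ `res₂ = res` for the transported pins -/

section Res

variable {W W₂ : WeierstrassCurve ℚ} [W.IsElliptic] [W₂.IsElliptic] {p : ℕ} [Fact p.Prime]
  [ContinuousSMul ℤ_[p] (W.tateModule p)] [ContinuousSMul ℤ_[p] (W₂.tateModule p)]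
  {K : Type} [Field K] [NumberField K]
  [ContinuousSMul ℤ_[p] ((W.baseChange K).tateModule p)] [ContinuousSMul ℤ_[p] ((W₂.baseChange K).tateModule p)]
  {κ : ZpExtension ℚ p} {h : Function.Surjective (κ.toContinuousMonoidHom.comp (absGaloisRestrict ℚ K))}
  {γ : absoluteGaloisGroup ℚ} {γK : absoluteGaloisGroup K}

/-- ★ (T4) **`res₂ = res` ON THE SAME CARRIERS.** For the partner pins obtained by transport of structure —
`I₂ := transportQ I β α e u …` and `IK₂ := transport IK (β.extendScalars K) (α.extendScalars K) e u …` — the restriction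
`I₂.resOver IK₂ hγ hγK : I.H → IK.H` coincides with `I.resOver IK hγ hγK`: levelwise (`proj_resOver`, `transportQ_proj`,
`transport_proj`) this is the square `layerResOver_isogenyMapH1`, and `IK₂.proj` is jointly injective (`proj_eq_iff`).
[cite: Rubin2000, App. B §3 (maps into an inverse limit are determined levelwise)] [cite: NeukirchSchmidtWingberg2008, I §5 Prop. 1.5.4] -/
theorem resOver_transportQ_transport (hγ : κ.IsTopGenerator γ) (hγK : (κ.restrict K h).IsTopGenerator γK)
    (I : IwasawaH1Data W p κ γ) (IK : IwasawaH1DataOver (W.baseChange K) p (κ.restrict K h) γK)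
    (β : Isogeny W W₂) (α : Isogeny W₂ W) (e : ℤ) (u : ℤ_[p]ˣ) (hu : (u : ℤ_[p]) = e)
    (hαβ : ∀ P, α (β P) = e • P) (hβα : ∀ P, β (α P) = e • P)
    (hαβK : ∀ Q, α.extendScalars K (β.extendScalars K Q) = e • Q) (hβαK : ∀ Q, β.extendScalars K (α.extendScalars K Q) = e • Q)
    (y : I.H) :
    (transportQ I β α e u hu hαβ hβα).resOver
        (transport IK (β.extendScalars K) (α.extendScalars K) e u hu hαβK hβαK) hγ hγK y =
      I.resOver IK hγ hγK y := by
  refine (transport IK (β.extendScalars K) (α.extendScalars K) e u hu hαβK hβαK).proj_eq_iff.mp fun n ↦ ?_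
  rw [IwasawaH1Data.proj_resOver, transportQ_proj, layerResOver_isogenyMapH1, transport_proj,
    IwasawaH1Data.proj_resOver]

/-- (T4) packaged with the `K`-side dual-pair hypotheses derived from the `ℚ`-side ones (`extendScalars_extendScalars_eq_zsmul`):
the successor's (T6)/(K-2) display only `β`, `α`, `e`, `u` and the two `ℚ`-identities. [cite: Rubin2000, App. B §3] -/
theorem resOver_transportQ_transport' (hγ : κ.IsTopGenerator γ) (hγK : (κ.restrict K h).IsTopGenerator γK)
    (I : IwasawaH1Data W p κ γ) (IK : IwasawaH1DataOver (W.baseChange K) p (κ.restrict K h) γK)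
    (β : Isogeny W W₂) (α : Isogeny W₂ W) (e : ℤ) (u : ℤ_[p]ˣ) (hu : (u : ℤ_[p]) = e)
    (hαβ : ∀ P, α (β P) = e • P) (hβα : ∀ P, β (α P) = e • P) (y : I.H) :
    (transportQ I β α e u hu hαβ hβα).resOver
        (transport IK (β.extendScalars K) (α.extendScalars K) e u hu
          (extendScalars_extendScalars_eq_zsmul K β α hαβ) (extendScalars_extendScalars_eq_zsmul K α β hβα)) hγ hγK y =
      I.resOver IK hγ hγK y :=
  resOver_transportQ_transport hγ hγK I IK β α e u hu hαβ hβα _ _ y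

end Res

end PartnerTransport

end Summit.BirchSwinnertonDyer.Rank1Residual.Additive.GenusSeven

end
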